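import Summits.CriticalPhenomena.PercolationContinuityZ3.Theorems.PercNearOneGluingNoHeavyLowerTailHullThreeEvents
import Summits.CriticalPhenomena.PercolationContinuityZ3.Theorems.PercNearOneGluingNoHeavyLowerTailHullThreeWorld
import HarnessLib

/-!
# `NoHeavyLowerTail` (stmt-CriticalPhenomena-4575) — hull-port line, THREE PORTS: the G-level quantities as outer integrals of
# the per-world functionals, and positivity of the integrated certificate

Hull-port prover #4 (`prim-hp-4`, LP-duality technique), generation 2; `--supports stmt-CriticalPhenomena-4575`.  No definitions, no
sorries, no named facts.  Companion of `…HullThreeEvents` (hull decomposition `decomp_event`) and `…HullThreeWorld` (per-world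
positivity `phi_nonneg`).

For a three-port hull `X` (region `R ∋ o`, ports `p 0, p 1, p 2`), relays `A` outside `R` containing the ports, level `j`,
`μ = prodBernoulli X.w`, `N = |π(o)|`, `M₀ = |π(p 0)|`:
* `U_eq`:  `μ(M₀ ≤ j, 1 ≤ N) − μ(1 ≤ N ≤ j) = Σ_b xlaw b · ∫ FU b (obits ω) (Hs ω) dμ`;
* `Sh_eq`: `μ(o↔p k, o↮p 0, M₀ ≤ j) − μ(o↔p k, o↮p 0, N ≤ j) = Σ_b xlaw b · ∫ FSh k b … dμ` (the shift rows);
* `A1_eq`, `A2_eq`, `A12_eq`: the observer-set rows `μ(p 0 ↮ O, M₀ ≤ j) − μ(p 0 ↮ O, 1 ≤ |π(O)| ≤ j)` for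
  `O = {p 1}, {p 2}, {p 1, p 2}` likewise (`FA1, FA2, FA12`);
* `cert_eq_integral`: `θ·U − Λ·(Sh₁ + Sh₂) − α1·A₁ − α2·A₂ − α12·A₁₂ = ∫ Phi xlaw θ Λ α1 α2 α12 (obits ω) (Hs ω) dμ`;
* `cert_nonneg` (**the integrated certificate**): if the multipliers satisfy `E1 = E2 = E3 = E4 = 0` and `k01, k02 ≥ 0` for the inner
  law `xlaw`, then `0 ≤ θ·U − Λ·(Sh₁ + Sh₂) − α1·A₁ − α2·A₂ − α12·A₁₂`.
-/

noncomputable section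

namespace Summit.CriticalPhenomena.PercolationContinuityZ3.Theorems

open MeasureTheory Set Literature.Probability.LatticeModels Literature.Probability.Percolation
open scoped Classical BigOperators

variable {n : ℕ}

namespace HullThree

namespace Hull3

variable {X : Hull3 n} {A : Finset (Fin n)} {j : ℕ}

/-- Observer count `N`. -/
abbrev Ncnt (X : Hull3 n) (A : Finset (Fin n)) (ω : BondConfig (Fin n)) : ℕ := (A.filter fun x => ω ∈ openConn X.o x).card

/-- Best-port count `M₀`. -/
abbrev Mcnt (X : Hull3 n) (A : Finset (Fin n)) (ω : BondConfig (Fin n)) : ℕ :=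
  (A.filter fun x => ω ∈ openConn (X.p 0) x).card

/-- Set count `|π(O)|`. -/
abbrev Scnt (A O : Finset (Fin n)) (ω : BondConfig (Fin n)) : ℕ := (A.filter fun z => ∃ x ∈ O, ω ∈ openConn x z).card

/-- Difference of integrals on the finite configuration space (everything is integrable). -/
theorem integral_sub' (f g : BondConfig (Fin n) → ℝ) :
    (∫ ω, f ω ∂(prodBernoulli X.w)) - ∫ ω, g ω ∂(prodBernoulli X.w) = ∫ ω, (f ω - g ω) ∂(prodBernoulli X.w) :=
  (integral_sub Integrable.of_finite Integrable.of_finite).symm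

/-- Two decompositions with the same pattern condition subtract to the integral of the difference. -/
theorem sum_decomp_sub (P : IB → OB → Prop) [∀ b c, Decidable (P b c)] (m m' : IB → OB → M3) :
    (∑ b : IB, X.xlaw b * ∫ ω, (if P b (X.obits ω) then X.Hs A j ω (m b (X.obits ω)) else 0) ∂(prodBernoulli X.w)) -
      ∑ b : IB, X.xlaw b * ∫ ω, (if P b (X.obits ω) then X.Hs A j ω (m' b (X.obits ω)) else 0) ∂(prodBernoulli X.w) =
    ∑ b : IB, X.xlaw b * ∫ ω, ((if P b (X.obits ω) then X.Hs A j ω (m b (X.obits ω)) else 0) -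
        (if P b (X.obits ω) then X.Hs A j ω (m' b (X.obits ω)) else 0)) ∂(prodBernoulli X.w) := by
  rw [← Finset.sum_sub_distrib]
  refine Finset.sum_congr rfl fun b _ => ?_
  rw [← mul_sub, integral_sub']

/-- **`U` as an outer integral.** -/
theorem U_eq (hA : ∀ a ∈ A, a ∉ X.R) (hpA : ∀ i, X.p i ∈ A) :
    (prodBernoulli X.w).real {ω | Mcnt X A ω ≤ j ∧ 1 ≤ Ncnt X A ω} -
        (prodBernoulli X.w).real {ω | 1 ≤ Ncnt X A ω ∧ Ncnt X A ω ≤ j} =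
      ∑ b : IB, X.xlaw b * ∫ ω, FU b (X.obits ω) (X.Hs A j ω) ∂(prodBernoulli X.w) := by
  rw [decomp_event (A := A) (j := j) (fun b _ => att b = true) (fun b c => blkP b c 0) _ fun ω hω => ?_,
    decomp_event (A := A) (j := j) (fun b _ => att b = true) (fun b c => blkS b c) _ fun ω hω => ?_]
  · exact sum_decomp_sub (fun b _ => att b = true) (fun b c => blkP b c 0) (fun b c => blkS b c)
  · show 1 ≤ Ncnt X A ω ∧ Ncnt X A ω ≤ j ↔ _
    rw [one_le_card_iff_att hA hpA hω, Ncnt, filter_obs_eq hA hω]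
  · show Mcnt X A ω ≤ j ∧ 1 ≤ Ncnt X A ω ↔ _
    rw [one_le_card_iff_att hA hpA hω, Mcnt, filter_port_eq hA hω 0, and_comm]

/-- **The shift rows as outer integrals.** -/
theorem Sh_eq (hA : ∀ a ∈ A, a ∉ X.R) (k : Fin 3) :
    (prodBernoulli X.w).real ((openConn X.o (X.p k) : Set (BondConfig (Fin n))) ∩ (openConn X.o (X.p 0))ᶜ ∩
          {ω | Mcnt X A ω ≤ j}) -
        (prodBernoulli X.w).real ((openConn X.o (X.p k) : Set (BondConfig (Fin n))) ∩ (openConn X.o (X.p 0))ᶜ ∩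
          {ω | Ncnt X A ω ≤ j}) =
      ∑ b : IB, X.xlaw b * ∫ ω, FSh k b (X.obits ω) (X.Hs A j ω) ∂(prodBernoulli X.w) := by
  rw [decomp_event (A := A) (j := j) (fun b c => (blkS b c).mem k = true ∧ (blkS b c).mem 0 = false) (fun b c => blkP b c 0) _
      fun ω hω => ?_,
    decomp_event (A := A) (j := j) (fun b c => (blkS b c).mem k = true ∧ (blkS b c).mem 0 = false) (fun b c => blkS b c) _
      fun ω hω => ?_]
  · exact sum_decomp_sub (fun b c => (blkS b c).mem k = true ∧ (blkS b c).mem 0 = false) (fun b c => blkP b c 0)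
      (fun b c => blkS b c)
  · simp only [mem_inter_iff, mem_compl_iff, mem_setOf_eq, mem_openConn_obs_iff hω, Ncnt, filter_obs_eq hA hω,
      Bool.not_eq_true, and_assoc]
  · simp only [mem_inter_iff, mem_compl_iff, mem_setOf_eq, mem_openConn_obs_iff hω, Mcnt, filter_port_eq hA hω 0,
      Bool.not_eq_true, and_assoc]

/-- **Observer-set row for `O = {p 1}` as an outer integral.** -/
theorem A1_eq (hA : ∀ a ∈ A, a ∉ X.R) (hpA : ∀ i, X.p i ∈ A) :
    (prodBernoulli X.w).real {ω | (∀ x ∈ ({X.p 1} : Finset (Fin n)), ω ∉ openConn (X.p 0) x) ∧ Mcnt X A ω ≤ j} -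
        (prodBernoulli X.w).real {ω | (∀ x ∈ ({X.p 1} : Finset (Fin n)), ω ∉ openConn (X.p 0) x) ∧
          1 ≤ Scnt A {X.p 1} ω ∧ Scnt A {X.p 1} ω ≤ j} =
      ∑ b : IB, X.xlaw b * ∫ ω, FA1 b (X.obits ω) (X.Hs A j ω) ∂(prodBernoulli X.w) := by
  rw [decomp_event (A := A) (j := j) (fun b c => (blkP b c 0).mem 1 = false) (fun b c => blkP b c 0) _ fun ω hω => ?_,
    decomp_event (A := A) (j := j) (fun b c => (blkP b c 0).mem 1 = false) (fun b c => blkP b c 1) _ fun ω hω => ?_]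
  · exact sum_decomp_sub (fun b c => (blkP b c 0).mem 1 = false) (fun b c => blkP b c 0) (fun b c => blkP b c 1)
  · simp only [one_le_card_set hpA ω {X.p 1} 1 (Finset.mem_singleton_self _), true_and, mem_setOf_eq]
    dsimp only [Scnt]
    rw [filter_single_eq hA hω 1]
    simp only [Finset.mem_singleton, forall_eq, mem_openConn_port_iff hω, Bool.not_eq_true]
  · simp only [mem_setOf_eq, Finset.mem_singleton, forall_eq, mem_openConn_port_iff hω, Mcnt, filter_port_eq hA hω 0,
      Bool.not_eq_true]

/-- **Observer-set row for `O = {p 2}` as an outer integral.** -/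
theorem A2_eq (hA : ∀ a ∈ A, a ∉ X.R) (hpA : ∀ i, X.p i ∈ A) :
    (prodBernoulli X.w).real {ω | (∀ x ∈ ({X.p 2} : Finset (Fin n)), ω ∉ openConn (X.p 0) x) ∧ Mcnt X A ω ≤ j} -
        (prodBernoulli X.w).real {ω | (∀ x ∈ ({X.p 2} : Finset (Fin n)), ω ∉ openConn (X.p 0) x) ∧
          1 ≤ Scnt A {X.p 2} ω ∧ Scnt A {X.p 2} ω ≤ j} =
      ∑ b : IB, X.xlaw b * ∫ ω, FA2 b (X.obits ω) (X.Hs A j ω) ∂(prodBernoulli X.w) := by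
  rw [decomp_event (A := A) (j := j) (fun b c => (blkP b c 0).mem 2 = false) (fun b c => blkP b c 0) _ fun ω hω => ?_,
    decomp_event (A := A) (j := j) (fun b c => (blkP b c 0).mem 2 = false) (fun b c => blkP b c 2) _ fun ω hω => ?_]
  · exact sum_decomp_sub (fun b c => (blkP b c 0).mem 2 = false) (fun b c => blkP b c 0) (fun b c => blkP b c 2)
  · simp only [one_le_card_set hpA ω {X.p 2} 2 (Finset.mem_singleton_self _), true_and, mem_setOf_eq]
    dsimp only [Scnt]
    rw [filter_single_eq hA hω 2]
    simp only [Finset.mem_singleton, forall_eq, mem_openConn_port_iff hω, Bool.not_eq_true]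
  · simp only [mem_setOf_eq, Finset.mem_singleton, forall_eq, mem_openConn_port_iff hω, Mcnt, filter_port_eq hA hω 0,
      Bool.not_eq_true]

/-- **Observer-set row for `O = {p 1, p 2}` as an outer integral.** -/
theorem A12_eq (hA : ∀ a ∈ A, a ∉ X.R) (hpA : ∀ i, X.p i ∈ A) :
    (prodBernoulli X.w).real {ω | (∀ x ∈ ({X.p 1, X.p 2} : Finset (Fin n)), ω ∉ openConn (X.p 0) x) ∧ Mcnt X A ω ≤ j} -
        (prodBernoulli X.w).real {ω | (∀ x ∈ ({X.p 1, X.p 2} : Finset (Fin n)), ω ∉ openConn (X.p 0) x) ∧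
          1 ≤ Scnt A {X.p 1, X.p 2} ω ∧ Scnt A {X.p 1, X.p 2} ω ≤ j} =
      ∑ b : IB, X.xlaw b * ∫ ω, FA12 b (X.obits ω) (X.Hs A j ω) ∂(prodBernoulli X.w) := by
  rw [decomp_event (A := A) (j := j) (fun b c => (blkP b c 0).mem 1 = false ∧ (blkP b c 0).mem 2 = false) (fun b c => blkP b c 0) _
      fun ω hω => ?_,
    decomp_event (A := A) (j := j) (fun b c => (blkP b c 0).mem 1 = false ∧ (blkP b c 0).mem 2 = false)
      (fun b c => (blkP b c 1).union (blkP b c 2)) _ fun ω hω => ?_]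
  · exact sum_decomp_sub (fun b c => (blkP b c 0).mem 1 = false ∧ (blkP b c 0).mem 2 = false) (fun b c => blkP b c 0)
      (fun b c => (blkP b c 1).union (blkP b c 2))
  · simp only [one_le_card_set hpA ω {X.p 1, X.p 2} 1 (by simp), true_and, mem_setOf_eq]
    dsimp only [Scnt]
    rw [filter_pair_eq hA hω]
    simp only [Finset.mem_insert, Finset.mem_singleton, forall_eq_or_imp, forall_eq, mem_openConn_port_iff hω,
      Bool.not_eq_true, and_assoc]
  · simp only [mem_setOf_eq, Finset.mem_insert, Finset.mem_singleton, forall_eq_or_imp, forall_eq,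
      mem_openConn_port_iff hω, Mcnt, filter_port_eq hA hω 0, Bool.not_eq_true, and_assoc]

/-- Linearity: the per-pattern integral of `lhsF`. -/
theorem integral_lhsF (θ Λ α1 α2 α12 : ℝ) (b : IB) :
    ∫ ω, lhsF θ Λ α1 α2 α12 b (X.obits ω) (X.Hs A j ω) ∂(prodBernoulli X.w) =
      θ * (∫ ω, FU b (X.obits ω) (X.Hs A j ω) ∂(prodBernoulli X.w)) -
        Λ * ((∫ ω, FSh 1 b (X.obits ω) (X.Hs A j ω) ∂(prodBernoulli X.w)) +
              ∫ ω, FSh 2 b (X.obits ω) (X.Hs A j ω) ∂(prodBernoulli X.w)) -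
        α1 * (∫ ω, FA1 b (X.obits ω) (X.Hs A j ω) ∂(prodBernoulli X.w)) -
        α2 * (∫ ω, FA2 b (X.obits ω) (X.Hs A j ω) ∂(prodBernoulli X.w)) -
        α12 * (∫ ω, FA12 b (X.obits ω) (X.Hs A j ω) ∂(prodBernoulli X.w)) := by
  have hi : ∀ f : BondConfig (Fin n) → ℝ, Integrable f (prodBernoulli X.w) := fun _ => Integrable.of_finite
  simp only [lhsF]
  rw [integral_sub (hi _) (hi _), integral_sub (hi _) (hi _), integral_sub (hi _) (hi _), integral_sub (hi _) (hi _),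
    integral_const_mul, integral_const_mul, integral_const_mul, integral_const_mul, integral_const_mul,
    integral_add (hi _) (hi _)]

/-- **The certificate combination as an outer integral of `Phi`.** -/
theorem cert_eq_integral (hA : ∀ a ∈ A, a ∉ X.R) (hpA : ∀ i, X.p i ∈ A) (θ Λ α1 α2 α12 : ℝ) :
    θ * ((prodBernoulli X.w).real {ω | Mcnt X A ω ≤ j ∧ 1 ≤ Ncnt X A ω} -
          (prodBernoulli X.w).real {ω | 1 ≤ Ncnt X A ω ∧ Ncnt X A ω ≤ j}) -
      Λ * (((prodBernoulli X.w).real ((openConn X.o (X.p 1) : Set (BondConfig (Fin n))) ∩ (openConn X.o (X.p 0))ᶜ ∩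
              {ω | Mcnt X A ω ≤ j}) -
            (prodBernoulli X.w).real ((openConn X.o (X.p 1) : Set (BondConfig (Fin n))) ∩ (openConn X.o (X.p 0))ᶜ ∩
              {ω | Ncnt X A ω ≤ j})) +
          ((prodBernoulli X.w).real ((openConn X.o (X.p 2) : Set (BondConfig (Fin n))) ∩ (openConn X.o (X.p 0))ᶜ ∩
              {ω | Mcnt X A ω ≤ j}) -
            (prodBernoulli X.w).real ((openConn X.o (X.p 2) : Set (BondConfig (Fin n))) ∩ (openConn X.o (X.p 0))ᶜ ∩
              {ω | Ncnt X A ω ≤ j}))) -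
      α1 * ((prodBernoulli X.w).real {ω | (∀ x ∈ ({X.p 1} : Finset (Fin n)), ω ∉ openConn (X.p 0) x) ∧ Mcnt X A ω ≤ j} -
          (prodBernoulli X.w).real {ω | (∀ x ∈ ({X.p 1} : Finset (Fin n)), ω ∉ openConn (X.p 0) x) ∧
            1 ≤ Scnt A {X.p 1} ω ∧ Scnt A {X.p 1} ω ≤ j}) -
      α2 * ((prodBernoulli X.w).real {ω | (∀ x ∈ ({X.p 2} : Finset (Fin n)), ω ∉ openConn (X.p 0) x) ∧ Mcnt X A ω ≤ j} -
          (prodBernoulli X.w).real {ω | (∀ x ∈ ({X.p 2} : Finset (Fin n)), ω ∉ openConn (X.p 0) x) ∧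
            1 ≤ Scnt A {X.p 2} ω ∧ Scnt A {X.p 2} ω ≤ j}) -
      α12 * ((prodBernoulli X.w).real {ω | (∀ x ∈ ({X.p 1, X.p 2} : Finset (Fin n)), ω ∉ openConn (X.p 0) x) ∧
              Mcnt X A ω ≤ j} -
          (prodBernoulli X.w).real {ω | (∀ x ∈ ({X.p 1, X.p 2} : Finset (Fin n)), ω ∉ openConn (X.p 0) x) ∧
            1 ≤ Scnt A {X.p 1, X.p 2} ω ∧ Scnt A {X.p 1, X.p 2} ω ≤ j}) =
    ∫ ω, Phi X.xlaw θ Λ α1 α2 α12 (X.obits ω) (X.Hs A j ω) ∂(prodBernoulli X.w) := by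
  rw [U_eq hA hpA, Sh_eq hA 1, Sh_eq hA 2, A1_eq hA hpA, A2_eq hA hpA, A12_eq hA hpA]
  simp only [Phi]
  rw [integral_finsetSum _ fun b _ => Integrable.of_finite]
  simp only [integral_const_mul, integral_lhsF, Finset.mul_sum, ← Finset.sum_add_distrib, ← Finset.sum_sub_distrib]
  refine Finset.sum_congr rfl fun b _ => ?_
  ring

/-- **The integrated certificate.**  If the multipliers satisfy the relations `E1 = E2 = E3 = E4 = 0` and the residual signs
`k01, k02 ≥ 0` for the inner law `xlaw`, then the certificate combination of the G-level quantities is nonnegative. -/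
theorem cert_nonneg (hA : ∀ a ∈ A, a ∉ X.R) (hpA : ∀ i, X.p i ∈ A) (θ Λ α1 α2 α12 : ℝ)
    (hE1 : E1 X.xlaw θ Λ α1 α2 α12 = 0) (hE2 : E2 X.xlaw θ Λ α1 = 0) (hE3 : E3 X.xlaw θ Λ α2 = 0)
    (hE4 : E4 X.xlaw θ Λ α1 α2 α12 = 0) (hk01 : 0 ≤ k01 X.xlaw θ Λ α2) (hk02 : 0 ≤ k02 X.xlaw θ Λ α1) :
    0 ≤ θ * ((prodBernoulli X.w).real {ω | Mcnt X A ω ≤ j ∧ 1 ≤ Ncnt X A ω} -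
          (prodBernoulli X.w).real {ω | 1 ≤ Ncnt X A ω ∧ Ncnt X A ω ≤ j}) -
      Λ * (((prodBernoulli X.w).real ((openConn X.o (X.p 1) : Set (BondConfig (Fin n))) ∩ (openConn X.o (X.p 0))ᶜ ∩
              {ω | Mcnt X A ω ≤ j}) -
            (prodBernoulli X.w).real ((openConn X.o (X.p 1) : Set (BondConfig (Fin n))) ∩ (openConn X.o (X.p 0))ᶜ ∩
              {ω | Ncnt X A ω ≤ j})) +
          ((prodBernoulli X.w).real ((openConn X.o (X.p 2) : Set (BondConfig (Fin n))) ∩ (openConn X.o (X.p 0))ᶜ ∩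
              {ω | Mcnt X A ω ≤ j}) -
            (prodBernoulli X.w).real ((openConn X.o (X.p 2) : Set (BondConfig (Fin n))) ∩ (openConn X.o (X.p 0))ᶜ ∩
              {ω | Ncnt X A ω ≤ j}))) -
      α1 * ((prodBernoulli X.w).real {ω | (∀ x ∈ ({X.p 1} : Finset (Fin n)), ω ∉ openConn (X.p 0) x) ∧ Mcnt X A ω ≤ j} -
          (prodBernoulli X.w).real {ω | (∀ x ∈ ({X.p 1} : Finset (Fin n)), ω ∉ openConn (X.p 0) x) ∧
            1 ≤ Scnt A {X.p 1} ω ∧ Scnt A {X.p 1} ω ≤ j}) -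
      α2 * ((prodBernoulli X.w).real {ω | (∀ x ∈ ({X.p 2} : Finset (Fin n)), ω ∉ openConn (X.p 0) x) ∧ Mcnt X A ω ≤ j} -
          (prodBernoulli X.w).real {ω | (∀ x ∈ ({X.p 2} : Finset (Fin n)), ω ∉ openConn (X.p 0) x) ∧
            1 ≤ Scnt A {X.p 2} ω ∧ Scnt A {X.p 2} ω ≤ j}) -
      α12 * ((prodBernoulli X.w).real {ω | (∀ x ∈ ({X.p 1, X.p 2} : Finset (Fin n)), ω ∉ openConn (X.p 0) x) ∧
              Mcnt X A ω ≤ j} -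
          (prodBernoulli X.w).real {ω | (∀ x ∈ ({X.p 1, X.p 2} : Finset (Fin n)), ω ∉ openConn (X.p 0) x) ∧
            1 ≤ Scnt A {X.p 1, X.p 2} ω ∧ Scnt A {X.p 1, X.p 2} ω ≤ j}) := by
  rw [cert_eq_integral hA hpA]
  refine integral_nonneg fun ω => ?_
  exact phi_nonneg X.xlaw θ Λ α1 α2 α12 (fun b hb => xlaw_eq_zero_of_not_closed b hb) hE1 hE2 hE3 hE4 hk01 hk02
    (X.obits ω) (X.Hs A j ω) (fun m m' h => Hs_antitone ω m m' h)

end Hull3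

end HullThree

end Summit.CriticalPhenomena.PercolationContinuityZ3.Theorems

end
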